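import Summits.NavierStokesRegularity.FunctionalMining.TopEigMixProduction
import Summits.NavierStokesRegularity.FunctionalMining.SpectralMixtureCandidates
import Summits.NavierStokesRegularity.FunctionalMining.TopEigSaturatingSup
import HarnessLib

/-!
# FunctionalMining — the right derivative of the mixture `F_ε = Φ_q + ε Z_q` along Navier–Stokes
# and its `T_LD` budget (K1-Q6 (a), part 1: the derivative step and the fencing tools)

Search for candidate a priori estimates; no regularity claim. Cell `pub-nsfunc`, prove seat
(gen 24). Part 1 of the proof that the dictionary's candidate law `TopEigStrainMixLaw q ε`
(`SpectralMixtureCandidates`: escape (a) of the no-go door D-K6) HOLDS for every real `q > 2` and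
every `ε > 0`; part 2 (`TopEigStrainMixLawHolds.lean`) draws the law and the rate exponent.

MECHANISM. Along a classical solution the non-smooth `Φ_q(u(s)) = ∫(λ₁⁺)^q(S)` has at every
`t ∈ [a, b)` a RIGHT derivative `R_Φ ≤ −ν T_q(u(t)) + 𝒩₊(t) ≤ 𝒩₊(t)` (`TopEigProductionSplit`: the
exact balance after LEMMA ADV; the heat sieve `T_q ≥ 0`, `TopEigHeatStable`), and the Euler production
is dominated by the strain-moment chain, `𝒩₊ ≤ q (C_N + C_Q) I^a M^{1−a}` (`TopEigMixProduction`);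
`Z_q(u(s)) = ∫|S|^q` is differentiable within the window with
`Z_q' ≤ −q ν I + q (C_N + C_Q) I^a M^{1−a}` (`StrainMomentBalance`, `StrainMomentProduction`). Hence
`F_ε' ≤ q [(1+ε)(C_N+C_Q) I^a M^{1−a} − ε ν I] ≤ q ((1+ε)(C_N+C_Q))^{1/(1−a)} (εν)^{−γ} M` (Young with
the weight `εν`), and `M = Z · Z_q^{1+1/σ} ≤ ε^{−(1+1/σ)} Z · F_ε^{1+1/σ}` (`Φ_q ≥ 0`): the viscous
term of `ε Z_q` absorbs the whole production of `Φ_q`, at the price `κ(ε) = C(q)(1+ε)^{1/(1−a)}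
ε^{−(γ+1+1/σ)}` (`a = (3q−3)/(5q−6)`, `σ = 2q−3`, `γ = (3q−3)/(2q−3) = a/(1−a)`).

* `TopEig.hasDerivWithinAt_le_of_fence` — real analysis: a fence `f(t₂) − f(t₁) ≤ K(t₂ − t₁)`
  whenever a budget (continuous within the window) is `≤ K` on `[t₁, t₂]` bounds every one-sided
  derivative value within the window by the budget (the Dini-fencing step of `TopEigSaturatingSup`,
  made generic);
* `TopEig.sub_le_mul_of_deriv_right_le` — a continuous function with right derivatives `≤ K` on
  `[t₁, t₂)` satisfies the fence (Mathlib's `image_le_of_deriv_right_le_deriv_boundary`);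
* **`TopEig.exists_topEigStrainMix_rightDeriv_le`** — the right derivative of `F_ε(u(s))` at every
  `t ∈ [a, b)` exists and is `≤ (q/2) C₀ (1+ε)^{1/(1−a)} ε^{−(γ+1+1/σ)} ν^{−γ} (2ℰ) F_ε^{1+1/σ}` with
  ONE `C₀ = C₀(q) ≥ 0` for all `ε > 0`, `ν > 0` and all unforced classical solutions on `T³`;
* `TopEig.continuousWithinAt_topEigStrainMix` — `s ↦ F_ε(u(s))` is continuous within the window.

Constants existential (Sobolev top node, strain and pressure-Hessian Calderón–Zygmund). Nothing here
is about Navier–Stokes regularity. [ours]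
-/

noncomputable section

open MeasureTheory Set Filter Topology Finset

namespace Summit.NavierStokesRegularity.FunctionalMining

open Literature.Analysis.FunctionSpaces Literature.Analysis.FluidPDE

namespace TopEig

open StrainL4 StrainMoment VorticityL4 StrainTensor Torus

/-! ## 1. Real analysis: derivative values from a fence, and the fence from right derivatives -/

/-- **Derivative values from a fence.** If `f(t₂) − f(t₁) ≤ K (t₂ − t₁)` for all `t₁ ≤ t₂` in
`[a, b]` and every `K` dominating `bud` on `[t₁, t₂]`, and `bud` is continuous within `[a, b]` at `t`,
then every derivative value of `f` within `[a, b]` at `t` is `≤ bud t`. [ours; Dini fencing] -/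
theorem hasDerivWithinAt_le_of_fence {f bud : ℝ → ℝ} {a b t : ℝ} (hab : a < b) (ht : t ∈ Icc a b)
    (hcont : ContinuousWithinAt bud (Icc a b) t)
    (hfence : ∀ ⦃t₁ t₂ : ℝ⦄, t₁ ∈ Icc a b → t₂ ∈ Icc a b → t₁ ≤ t₂ → ∀ ⦃K : ℝ⦄,
      (∀ σ ∈ Icc t₁ t₂, bud σ ≤ K) → f t₂ - f t₁ ≤ K * (t₂ - t₁))
    {R : ℝ} (hR : HasDerivWithinAt f R (Icc a b) t) : R ≤ bud t := by
  -- adapted from TopEigSaturatingSup.hasDerivWithinAt_le_of_heatCoercive_admissible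
  refine le_of_forall_gt_imp_ge_of_dense fun r hr => ?_
  set r' : ℝ := (bud t + r) / 2 with hr'
  have hr't : bud t < r' := by rw [hr']; linarith
  have hr'r : r' < r := by rw [hr']; linarith
  obtain ⟨δ, hδ, hδP⟩ := Metric.continuousWithinAt_iff.1 hcont (r' - bud t) (by linarith)
  have hnear : ∀ σ ∈ Icc a b, dist σ t < δ → bud σ ≤ r' := by
    intro σ hσ hd
    have h := hδP hσ hd
    rw [Real.dist_eq, abs_lt] at h
    linarith [h.2]
  rcases lt_or_eq_of_le ht.2 with htb | htb
  · set z₀ : ℝ := min (t + δ) b with hz₀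
    have htz₀ : t < z₀ := lt_min (by linarith) htb
    have hsub : Ioo t z₀ ⊆ Icc a b := fun z hz =>
      ⟨ht.1.trans hz.1.le, (le_of_lt hz.2).trans (min_le_right _ _)⟩
    have hR' : HasDerivWithinAt f R (Ioo t z₀) t := hR.mono hsub
    have htend := (hasDerivWithinAt_iff_tendsto_slope' (by simp : t ∉ Ioo t z₀)).mp hR'
    haveI : (𝓝[Ioo t z₀] t).NeBot := left_nhdsWithin_Ioo_neBot htz₀
    have hev : ∀ᶠ z in 𝓝[Ioo t z₀] t, slope f t z ≤ r' := by
      filter_upwards [self_mem_nhdsWithin] with z hz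
      have hzab : z ∈ Icc a b := hsub hz
      have hKz : ∀ σ ∈ Icc t z, bud σ ≤ r' := by
        intro σ hσ
        refine hnear σ ⟨ht.1.trans hσ.1, hσ.2.trans hzab.2⟩ ?_
        rw [Real.dist_eq, abs_of_nonneg (by linarith [hσ.1])]
        have : z < t + δ := lt_of_lt_of_le hz.2 (min_le_left _ _)
        linarith [hσ.2]
      have h := hfence ht hzab hz.1.le hKz
      rw [slope_def_field, div_le_iff₀ (by linarith [hz.1])]
      linarith
    exact (le_of_tendsto htend hev).trans hr'r.le
  · have hat : a < t := by rw [htb]; exact hab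
    set z₀ : ℝ := max (t - δ) a with hz₀
    have hz₀t : z₀ < t := max_lt (by linarith) hat
    have hsub : Ioo z₀ t ⊆ Icc a b := fun z hz =>
      ⟨(le_max_right _ _).trans hz.1.le, hz.2.le.trans ht.2⟩
    have hR' : HasDerivWithinAt f R (Ioo z₀ t) t := hR.mono hsub
    have htend := (hasDerivWithinAt_iff_tendsto_slope' (by simp : t ∉ Ioo z₀ t)).mp hR'
    haveI : (𝓝[Ioo z₀ t] t).NeBot := right_nhdsWithin_Ioo_neBot hz₀t
    have hev : ∀ᶠ z in 𝓝[Ioo z₀ t] t, slope f t z ≤ r' := by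
      filter_upwards [self_mem_nhdsWithin] with z hz
      have hzab : z ∈ Icc a b := hsub hz
      have hKz : ∀ σ ∈ Icc z t, bud σ ≤ r' := by
        intro σ hσ
        refine hnear σ ⟨hzab.1.trans hσ.1, hσ.2.trans ht.2⟩ ?_
        rw [Real.dist_eq, abs_of_nonpos (by linarith [hσ.2])]
        have : t - δ < z := lt_of_le_of_lt (le_max_left _ _) hz.1
        linarith [hσ.1]
      have h := hfence hzab ht hz.2.le hKz
      have e : slope f t z = (f t - f z) / (t - z) := by
        rw [slope_def_field, ← neg_sub (f t) (f z), ← neg_sub t z, neg_div_neg_eq]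
      rw [e, div_le_iff₀ (by linarith [hz.2])]
      linarith
    exact (le_of_tendsto htend hev).trans hr'r.le

/-- **The fence from right derivatives.** A function continuous on `[t₁, t₂]` with right
derivatives `≤ K` at every point of `[t₁, t₂)` satisfies `f(t₂) − f(t₁) ≤ K (t₂ − t₁)`. [folklore] -/
theorem sub_le_mul_of_deriv_right_le {f f' : ℝ → ℝ} {t₁ t₂ K : ℝ} (h12 : t₁ ≤ t₂)
    (hf : ContinuousOn f (Icc t₁ t₂)) (hder : ∀ x ∈ Ico t₁ t₂, HasDerivWithinAt f (f' x) (Ici x) x)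
    (hbound : ∀ x ∈ Ico t₁ t₂, f' x ≤ K) : f t₂ - f t₁ ≤ K * (t₂ - t₁) := by
  have hB : ContinuousOn (fun x => f t₁ + K * (x - t₁)) (Icc t₁ t₂) :=
    (continuousOn_const.add (continuousOn_const.mul (continuousOn_id.sub continuousOn_const)))
  have hB' : ∀ x ∈ Ico t₁ t₂, HasDerivWithinAt (fun x => f t₁ + K * (x - t₁)) K (Ici x) x := by
    intro x _
    have h := ((hasDerivAt_id x).sub_const t₁).const_mul K |>.const_add (f t₁)
    simpa using h.hasDerivWithinAt
  have h := image_le_of_deriv_right_le_deriv_boundary hf hder (by simp) hB hB' hbound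
    (right_mem_Icc.2 h12)
  linarith

/-! ## 2. The right derivative of `F_ε(u(s))` and its `T_LD` bound -/

variable {q : ℝ}

/-- **The right derivative of `F_ε = Φ_q + ε Z_q` along Navier–Stokes and its `T_LD` budget.** For
real `q > 2` there is `C₀ ≥ 0` (depending on `q` only) such that for every `ε > 0`, every `ν > 0` and
every classical solution of unforced Navier–Stokes on `T³ × [a, b]`, at every `t ∈ [a, b)`:
`s ↦ F_ε(u(s))` has a right derivative `R` within `[t, ∞)` with
`R ≤ (q/2) C₀ (1+ε)^{1/(1−a)} ε^{−(γ + 1 + 1/σ)} ν^{−γ} (2ℰ(u t)) F_ε(u t)^{1+1/σ}`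
(`a = (3q−3)/(5q−6)`, `σ = 2q−3`, `γ = (3q−3)/(2q−3)`). [ours] -/
theorem exists_topEigStrainMix_rightDeriv_le (hq : 2 < q) :
    ∃ C₀ : ℝ, 0 ≤ C₀ ∧ ∀ {ε : ℝ}, 0 < ε → ∀ {ν a b : ℝ}, 0 < ν → a < b →
      ∀ {u : ℝ → UnitAddTorus (Fin 3) → EuclideanSpace ℝ (Fin 3)} {p : ℝ → UnitAddTorus (Fin 3) → ℝ},
      Torus.IsClassicalNSSolutionOn (Icc a b) ν 0 u p → ∀ {t : ℝ}, t ∈ Ico a b →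
      ∃ R : ℝ, HasDerivWithinAt (fun s => topEigStrainMix q ε (u s)) R (Ici t) t ∧
        R ≤ q / 2 * C₀ * (1 + ε) ^ (1 / (1 - (3 * q - 3) / (5 * q - 6))) *
          ε ^ (-((3 * q - 3) / (2 * q - 3) + (1 + (2 * q - 3)⁻¹))) * ν ^ (-((3 * q - 3) / (2 * q - 3))) *
          ((2 * torusEnstrophy (u t)) * topEigStrainMix q ε (u t) ^ (1 + (2 * q - 3)⁻¹)) := by
  -- the static constants of the strain-moment chain
  obtain ⟨CT, hCT0, hCT⟩ := exists_top_rpow hq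
  obtain ⟨K, hK0, hK⟩ := exists_cz_rpow (q := q) (by linarith)
  obtain ⟨CP, hCP0, hCP⟩ := exists_hess_rpow (d := Fin 3) (q := q) (by linarith)
  obtain ⟨e, he⟩ : ∃ e : ℝ, e = (3 * q - 3) / (5 * q - 6) := ⟨_, rfl⟩
  obtain ⟨CN, hCN⟩ : ∃ C : ℝ, C = Real.sqrt 2 * K ^ (1 / q) * CT ^ (e / 3) := ⟨_, rfl⟩
  obtain ⟨CQ, hCQ⟩ : ∃ C : ℝ,
      C = Real.sqrt 2 * ((9 : ℝ) ^ q * CP * K) ^ (1 / q) * CT ^ (e / 3) := ⟨_, rfl⟩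
  have h56 : 0 < 5 * q - 6 := by linarith
  have h23 : 0 < 2 * q - 3 := by linarith
  have he0 : 0 < e := by rw [he]; exact div_pos (by linarith) h56
  have he1 : e < 1 := by rw [he, div_lt_one h56]; linarith
  have h1e : 1 - e = (2 * q - 3) / (5 * q - 6) := by
    rw [he, one_sub_div h56.ne']; congr 1; ring
  have hγ : e / (1 - e) = (3 * q - 3) / (2 * q - 3) := by
    rw [h1e, he, div_div_div_cancel_right₀ h56.ne']
  have h9 : 0 ≤ (9 : ℝ) ^ q * CP * K := by positivity
  have hCN0 : 0 ≤ CN := by rw [hCN]; positivity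
  have hCQ0 : 0 ≤ CQ := by rw [hCQ]; positivity
  have hC0 : 0 ≤ CN + CQ := add_nonneg hCN0 hCQ0
  refine ⟨(CN + CQ) ^ (1 / (1 - e)), Real.rpow_nonneg hC0 _, ?_⟩
  intro ε hε ν a b hν hab u p hsol t ht
  have ht' : t ∈ Icc a b := ⟨ht.1, ht.2.le⟩
  have hq1 : (1 : ℝ) ≤ q := by linarith
  have hq0 : (0 : ℝ) ≤ q := by linarith
  have hut : IsSmooth (u t) := hsol.smooth_velocity.isSmooth_slice ht'
  have hdiv : IsDivFree (u t) := hsol.divFree t ht'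
  -- opaque names for the slice quantities
  obtain ⟨XN, hXN⟩ : ∃ X : ℝ, X = ∫ x, torusStrainSqAt (u t) x ^ (q / 2 - 1) * ∑ i, ∑ j,
      (partialDeriv j (u t) x i + partialDeriv i (u t) x j) / 2 *
        ∑ k, partialDeriv i (u t) x k * partialDeriv k (u t) x j := ⟨_, rfl⟩
  obtain ⟨XP, hXP⟩ : ∃ X : ℝ, X = ∫ x, torusStrainSqAt (u t) x ^ (q / 2 - 1) * ∑ i, ∑ j,
      (partialDeriv j (u t) x i + partialDeriv i (u t) x j) / 2 *
        partialDeriv i (partialDeriv j (p t)) x := ⟨_, rfl⟩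
  obtain ⟨I', hI'⟩ : ∃ I : ℝ, I = ∫ x, torusStrainSqAt (u t) x ^ (q / 2 - 1) * ∑ k, ∑ i, ∑ j,
      ((partialDeriv k (partialDeriv j (u t)) x i +
        partialDeriv k (partialDeriv i (u t)) x j) / 2) ^ 2 := ⟨_, rfl⟩
  obtain ⟨I, hI⟩ : ∃ I : ℝ, I = ∫ x, ‖strainFlat (u t) x‖ ^ (q - 2) * ∑ k, ∑ i, ∑ j,
      ((partialDeriv k (partialDeriv j (u t)) x i +
        partialDeriv k (partialDeriv i (u t)) x j) / 2) ^ 2 := ⟨_, rfl⟩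
  obtain ⟨Z, hZ⟩ : ∃ Z : ℝ, Z = ∫ x, ‖strainFlat (u t) x‖ ^ (2 : ℝ) := ⟨_, rfl⟩
  obtain ⟨F, hFq⟩ : ∃ F : ℝ, F = ∫ x, ‖strainFlat (u t) x‖ ^ q := ⟨_, rfl⟩
  obtain ⟨M, hM⟩ : ∃ M : ℝ, M = Z * F ^ (1 + (2 * q - 3)⁻¹) := ⟨_, rfl⟩
  obtain ⟨NP, hNP⟩ : ∃ N : ℝ, N = ∫ x, q * torusStrainTopEig (u t) x ^ (q - 1) *
      dirTopEig (strainFlat (u t) x) (-pressVec (p t) x - nonlinVec (u t) x) := ⟨_, rfl⟩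
  have hII : I' = I := by
    rw [hI', hI]
    exact integral_congr_ae (ae_of_all _ fun x => by
      show torusStrainSqAt (u t) x ^ (q / 2 - 1) * _ = ‖strainFlat (u t) x‖ ^ (q - 2) * _
      rw [strainSqAt_rpow_half_sub_one])
  have hI0 : 0 ≤ I := by
    rw [hI]; exact integral_nonneg fun x => mul_nonneg (Real.rpow_nonneg (norm_nonneg _) _)
      (Finset.sum_nonneg fun k _ => Finset.sum_nonneg fun i _ =>
        Finset.sum_nonneg fun j _ => sq_nonneg _)
  have hZ0 : 0 ≤ Z := by rw [hZ]; exact integral_nonneg fun x => Real.rpow_nonneg (norm_nonneg _) _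
  have hF0 : 0 ≤ F := by rw [hFq]; exact integral_nonneg fun x => Real.rpow_nonneg (norm_nonneg _) _
  have hpw : 0 ≤ 1 + (2 * q - 3)⁻¹ := by have := inv_pos.2 h23; linarith
  have hM0 : 0 ≤ M := by rw [hM]; exact mul_nonneg hZ0 (Real.rpow_nonneg hF0 _)
  have hsplit : (CT * I ^ 3) ^ (e / 3) = CT ^ (e / 3) * I ^ e := by
    rw [Real.mul_rpow hCT0 (pow_nonneg hI0 3), ← Real.rpow_natCast I 3, ← Real.rpow_mul hI0]
    congr 2
    push_cast
    ring
  -- the static bounds of the strain-moment productions and of the Euler production of `Φ_q`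
  have hstatN : |XN| ≤ CN * I ^ e * M ^ (1 - e) := by
    have h := nonlinear_production_rpow_le hK0 hq hCT hK hut hdiv
    rw [← hXN, ← hI, ← hZ, ← hFq, ← he, ← hM, hsplit] at h
    calc |XN| ≤ Real.sqrt 2 * K ^ (1 / q) * (CT ^ (e / 3) * I ^ e) * M ^ (1 - e) := h
      _ = CN * I ^ e * M ^ (1 - e) := by rw [hCN]; ring
  have hstatP : |XP| ≤ CQ * I ^ e * M ^ (1 - e) := by
    have h := pressure_production_rpow_le hK0 hCP0 hq hCT hK hsol
      (fun s hs i j => hCP hab hsol s hs i j) ht'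
    rw [← hXP, ← hI, ← hZ, ← hFq, ← he, ← hM, hsplit] at h
    calc |XP| ≤ Real.sqrt 2 * ((9 : ℝ) ^ q * CP * K) ^ (1 / q) * (CT ^ (e / 3) * I ^ e) *
        M ^ (1 - e) := h
      _ = CQ * I ^ e * M ^ (1 - e) := by rw [hCQ]; ring
  have hstatE : NP ≤ q * ((CN + CQ) * I ^ e * M ^ (1 - e)) := by
    have h := eulerProduction_le_chain hK0 hCP0 hCT0 hq hCT hK hsol
      (fun s hs i j => hCP hab hsol s hs i j) ht'
    rw [← hNP, ← hI, ← hZ, ← hFq, ← he, ← hM] at h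
    calc NP ≤ q * ((Real.sqrt 2 * K ^ (1 / q) * CT ^ (e / 3) +
          Real.sqrt 2 * ((9 : ℝ) ^ q * CP * K) ^ (1 / q) * CT ^ (e / 3)) * I ^ e * M ^ (1 - e)) := h
      _ = q * ((CN + CQ) * I ^ e * M ^ (1 - e)) := by rw [hCN, hCQ]
  -- the right derivative of `Φ_q` (transport-free), with the heat sieve `T_q ≥ 0`
  obtain ⟨RΦ, hRΦ, hRΦle, -⟩ := hasDerivWithinAt_topEigMoment_le_heat_add_production hν.le hsol hab hq1 ht
  have hT0 : 0 ≤ heatDissipation (torusTopEigMoment q) (u t) :=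
    heatDissipation_nonneg_of_admissible hq1 convexOn_lam lipschitzWith_lam
      (fun _ hv hdv x => lam_strainFlat_nonneg hv hdv x)
      (fun _ hv hdv => torusTopEigMoment_eq hv hdv q) hut hdiv
  have hNPeq : ∫ x, q * torusStrainTopEig (u t) x ^ (q - 1) * dirTopEig (strainFlat (u t) x)
      (-pressVec (p t) x + strainFlat ((0 : ℝ → UnitAddTorus (Fin 3) → EuclideanSpace ℝ (Fin 3)) t) x -
        nonlinVec (u t) x) = NP := by
    rw [hNP]
    exact integral_congr_ae (ae_of_all _ fun x => by simp only [Pi.zero_apply, strainFlat_zero, add_zero])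
  have hRΦ' : RΦ ≤ q * ((CN + CQ) * I ^ e * M ^ (1 - e)) := by
    rw [hNPeq] at hRΦle
    have : -(ν * heatDissipation (torusTopEigMoment q) (u t)) ≤ 0 := by
      have := mul_nonneg hν.le hT0; linarith
    linarith
  -- the derivative of `Z_q` within the window, moved to `[t, ∞)`
  obtain ⟨hdiffZ, hleZ⟩ := GradientTensor.derivWithin_Bq_le hab hν.le hsol hq ht'
  rw [← hXN, ← hXP, ← hI', hII] at hleZ
  obtain ⟨DZ, hDZ⟩ : ∃ D : ℝ,
      D = derivWithin (fun s => ∫ x, torusStrainSqAt (u s) x ^ (q / 2)) (Icc a b) t := ⟨_, rfl⟩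
  rw [← hDZ] at hleZ
  have hZder : HasDerivWithinAt (fun s => torusStrainMoment q (u s)) DZ (Ici t) t := by
    have h1 : HasDerivWithinAt (fun s => ∫ x, torusStrainSqAt (u s) x ^ (q / 2)) DZ (Icc a b) t := by
      rw [hDZ]; exact hdiffZ.hasDerivWithinAt
    have hmem : Icc a b ∈ 𝓝[Ici t] t := by
      have h2 : Ici t ∩ Iio b ∈ 𝓝[Ici t] t := inter_mem_nhdsWithin _ (Iio_mem_nhds ht.2)
      exact Filter.mem_of_superset h2 fun y hy => ⟨ht.1.trans hy.1, hy.2.le⟩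
    exact h1.mono_of_mem_nhdsWithin hmem
  have hDZle : DZ ≤ -(q * ν * I) + q * ((CN + CQ) * I ^ e * M ^ (1 - e)) := by
    have hXN' : -XN ≤ |XN| := neg_le_abs XN
    have hXP' : -XP ≤ |XP| := neg_le_abs XP
    have h1 : -XN + -XP ≤ (CN + CQ) * I ^ e * M ^ (1 - e) := by
      have := add_le_add (hXN'.trans hstatN) (hXP'.trans hstatP); linarith
    have h2 := mul_le_mul_of_nonneg_left h1 hq0
    linarith
  -- the right derivative of `F_ε`
  have hΦder : HasDerivWithinAt (fun s => torusTopEigMoment q (u s)) RΦ (Ici t) t :=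
    hasDerivWithinAt_Ioi_iff_Ici.1 hRΦ
  have hFder : HasDerivWithinAt (fun s => topEigStrainMix q ε (u s)) (RΦ + ε * DZ) (Ici t) t := by
    have h := hΦder.add (hZder.const_mul ε)
    exact h
  refine ⟨RΦ + ε * DZ, hFder, ?_⟩
  -- Young with the weight `εν`
  have hεν : 0 < ε * ν := mul_pos hε hν
  have ha0 : 0 ≤ (1 + ε) * (CN + CQ) := mul_nonneg (by linarith) hC0
  have hY := VorticityMoment.young_rpow he0 he1 ha0 hI0 hM0 hεν
  -- an opaque name for the common production size
  obtain ⟨P, hP⟩ : ∃ P : ℝ, P = (CN + CQ) * I ^ e * M ^ (1 - e) := ⟨_, rfl⟩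
  rw [← hP] at hRΦ' hDZle
  have hY' : (1 + ε) * P - ε * ν * I ≤
      ((1 + ε) * (CN + CQ)) ^ (1 / (1 - e)) * (ε * ν) ^ (-(e / (1 - e))) * M := by
    have e0 : (1 + ε) * (CN + CQ) * I ^ e * M ^ (1 - e) = (1 + ε) * P := by rw [hP]; ring
    rw [e0] at hY
    linarith
  have hstep1 : RΦ + ε * DZ ≤ q * (((1 + ε) * (CN + CQ)) ^ (1 / (1 - e)) * (ε * ν) ^ (-(e / (1 - e))) * M) := by
    have h2 : ε * DZ ≤ ε * (-(q * ν * I) + q * P) := mul_le_mul_of_nonneg_left hDZle hε.le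
    have h1 : RΦ + ε * DZ ≤ q * ((1 + ε) * P - ε * ν * I) := by
      have h3 := add_le_add hRΦ' h2
      have e0 : q * P + ε * (-(q * ν * I) + q * P) = q * ((1 + ε) * P - ε * ν * I) := by ring
      linarith
    exact h1.trans (mul_le_mul_of_nonneg_left hY' hq0)
  -- `M ≤ ε^{-(1+1/σ)} Z F_ε^{1+1/σ}`
  have hZE : Z = torusEnstrophy (u t) := by rw [hZ]; exact (torusEnstrophy_eq_integral_norm_sq hut hdiv).symm
  have hFZ : F = torusStrainMoment q (u t) := by rw [hFq, torusStrainMoment_eq_integral_norm]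
  have hFε0 : 0 ≤ topEigStrainMix q ε (u t) := topEigStrainMix_nonneg hε.le _
  have hFle : F ≤ ε⁻¹ * topEigStrainMix q ε (u t) := by
    rw [hFZ, topEigStrainMix, mul_add, ← mul_assoc, inv_mul_cancel₀ hε.ne', one_mul]
    have := torusTopEigMoment_nonneg q (u t)
    have : 0 ≤ ε⁻¹ * torusTopEigMoment q (u t) := mul_nonneg (inv_nonneg.2 hε.le) this
    linarith
  have hMle : M ≤ ε ^ (-(1 + (2 * q - 3)⁻¹)) * (torusEnstrophy (u t) *
      topEigStrainMix q ε (u t) ^ (1 + (2 * q - 3)⁻¹)) := by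
    rw [hM, ← hZE]
    have h1 : F ^ (1 + (2 * q - 3)⁻¹) ≤ (ε⁻¹ * topEigStrainMix q ε (u t)) ^ (1 + (2 * q - 3)⁻¹) :=
      Real.rpow_le_rpow hF0 hFle hpw
    rw [Real.mul_rpow (inv_nonneg.2 hε.le) hFε0, Real.inv_rpow hε.le, ← Real.rpow_neg hε.le] at h1
    calc Z * F ^ (1 + (2 * q - 3)⁻¹)
        ≤ Z * (ε ^ (-(1 + (2 * q - 3)⁻¹)) * topEigStrainMix q ε (u t) ^ (1 + (2 * q - 3)⁻¹)) :=
          mul_le_mul_of_nonneg_left h1 hZ0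
      _ = _ := by ring
  -- assemble
  have hA0 : 0 ≤ q * (((1 + ε) * (CN + CQ)) ^ (1 / (1 - e)) * (ε * ν) ^ (-(e / (1 - e)))) :=
    mul_nonneg hq0 (mul_nonneg (Real.rpow_nonneg ha0 _) (Real.rpow_nonneg hεν.le _))
  have hstep2 : RΦ + ε * DZ ≤ q * (((1 + ε) * (CN + CQ)) ^ (1 / (1 - e)) * (ε * ν) ^ (-(e / (1 - e)))) *
      (ε ^ (-(1 + (2 * q - 3)⁻¹)) * (torusEnstrophy (u t) * topEigStrainMix q ε (u t) ^ (1 + (2 * q - 3)⁻¹))) := by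
    calc RΦ + ε * DZ ≤ q * (((1 + ε) * (CN + CQ)) ^ (1 / (1 - e)) * (ε * ν) ^ (-(e / (1 - e))) * M) := hstep1
      _ = q * (((1 + ε) * (CN + CQ)) ^ (1 / (1 - e)) * (ε * ν) ^ (-(e / (1 - e)))) * M := by ring
      _ ≤ _ := mul_le_mul_of_nonneg_left hMle hA0
  have e1 : ((1 + ε) * (CN + CQ)) ^ (1 / (1 - e)) = (1 + ε) ^ (1 / (1 - e)) * (CN + CQ) ^ (1 / (1 - e)) :=
    Real.mul_rpow (by linarith) hC0
  have e2 : (ε * ν) ^ (-(e / (1 - e))) = ε ^ (-(e / (1 - e))) * ν ^ (-(e / (1 - e))) :=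
    Real.mul_rpow hε.le hν.le
  have e3 : ε ^ (-((3 * q - 3) / (2 * q - 3) + (1 + (2 * q - 3)⁻¹))) =
      ε ^ (-(e / (1 - e))) * ε ^ (-(1 + (2 * q - 3)⁻¹)) := by
    rw [← hγ, neg_add, Real.rpow_add hε]
  rw [← he, e3, ← hγ]
  calc RΦ + ε * DZ ≤ _ := hstep2
    _ = q / 2 * (CN + CQ) ^ (1 / (1 - e)) * (1 + ε) ^ (1 / (1 - e)) *
        (ε ^ (-(e / (1 - e))) * ε ^ (-(1 + (2 * q - 3)⁻¹))) * ν ^ (-(e / (1 - e))) *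
        (2 * torusEnstrophy (u t) * topEigStrainMix q ε (u t) ^ (1 + (2 * q - 3)⁻¹)) := by
      rw [e1, e2]; ring

/-! ## 3. Continuity of `F_ε(u(s))` and of the budget along a solution -/

/-- `s ↦ F_ε(u(s))` is continuous within the window along a classical solution (`q > 2`). [ours] -/
theorem continuousWithinAt_topEigStrainMix (hq : 2 < q) (ε : ℝ) {ν a b : ℝ} (hν : 0 ≤ ν) (hab : a < b)
    {u : ℝ → UnitAddTorus (Fin 3) → EuclideanSpace ℝ (Fin 3)} {p : ℝ → UnitAddTorus (Fin 3) → ℝ}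
    (hsol : Torus.IsClassicalNSSolutionOn (Icc a b) ν 0 u p) {t : ℝ} (ht : t ∈ Icc a b) :
    ContinuousWithinAt (fun s => topEigStrainMix q ε (u s)) (Icc a b) t := by
  have hU : UniqueDiffOn ℝ (Icc a b) := uniqueDiffOn_Icc hab
  have hu : Torus.IsSmoothSpaceTimeOn (Icc a b) u := hsol.smooth_velocity
  have hΦ : ContinuousWithinAt (fun s => torusTopEigMoment q (u s)) (Icc a b) t :=
    (continuousOn_integral_comp_strain hU hu continuous_lam (by linarith : (0 : ℝ) ≤ q)).congr
      (fun s hs => torusTopEigMoment_eq (hu.isSmooth_slice hs) (hsol.divFree s hs) q) t ht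
  have hZ : ContinuousWithinAt (fun s => torusStrainMoment q (u s)) (Icc a b) t :=
    (GradientTensor.derivWithin_Bq_le hab hν hsol hq ht).1.continuousWithinAt
  exact hΦ.add (continuousWithinAt_const.mul hZ)

end TopEig

end Summit.NavierStokesRegularity.FunctionalMining

end
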